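import Mathlib

/-!
# Crux `ReggeStarCoercivity.DefectFreeCrystallizes` (stmt-AtomisticToContinuum-13603), line `prestress-split-korn`:
# the PRESTRESS SPLIT identity (engine S4, algebraic core)

The exact, potential-free identity behind the engine `stub_splitCoercivity` of the line (idea card
`Cruxes/DefectFreeCrystallizes/Ideas/prestress-split-korn.md`, "First lemma"; triage r1-1/2/3: "an exact algebraic
identity, TRUE"): write every pair term as a function of the squared bond length, `V(|b|) = W(|b|²)`, pick a reference
configuration `y` with bond vectors `ē = y j − y i` and per-bond tensions `ω i j` (for Lennard-Jones `ω = W'(|ē|²)`, but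
the identity holds for ANY symmetric weights), and tilt the wells, `W̃(v) = W(|v|²) − ω|v|²`. Then, bond by bond,

  `W(|b|²) − W(|ē|²) = [W̃(b) − W̃(ē)] + ω |b − ē|² + 2ω ⟪ē, b − ē⟫`        (`bond_split`)

(just `|b|² = |ē|² + 2⟪ē, b − ē⟫ + |b − ē|²`), and summed over ordered pairs with symmetric weights the linear terms
collect into `−2 Σ_i ⟪F_i, u_i⟫` with the reference FORCES `F_i = Σ_j ω i j (y j − y i)` (written out, no new definition) and displacements `u = x − y`
(`sum_linear_eq_forces`), so that on every set of indices where the reference is force-balanced the linear term is a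
pure boundary flux (`sum_linear_eq_boundary`). The three pieces are then estimated separately by the line: tilted strut
wells by S1 (`stub_tiltedWells`, landed), the transverse strut term `ω|b − ē|²` (ω < 0) by the rigidity constant of S2,
cables (ω > 0) dropped, and the flux by the zero-stress moment identities (S4).
-/

noncomputable section

open scoped BigOperators InnerProductSpace

namespace Summit.AtomisticToContinuum.Crystallization.Theorems.PrestressSplitKorn

variable {E : Type*} [NormedAddCommGroup E] [InnerProductSpace ℝ E]

/-- **Bond-wise prestress split.** For a well `W` of the squared length, a tension `ω`, a bond vector `b` and a
reference bond vector `e`: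
`W ‖b‖² − W ‖e‖² = (W ‖b‖² − ω‖b‖²) − (W ‖e‖² − ω‖e‖²) + ω‖b − e‖² + 2ω⟪e, b − e⟫`. -/
theorem bond_split (W : ℝ → ℝ) (ω : ℝ) (b e : E) :
    W (‖b‖ ^ 2) - W (‖e‖ ^ 2) =
      ((W (‖b‖ ^ 2) - ω * ‖b‖ ^ 2) - (W (‖e‖ ^ 2) - ω * ‖e‖ ^ 2)) +
        ω * ‖b - e‖ ^ 2 + 2 * ω * ⟪e, b - e⟫_ℝ := by
  have h : ‖b‖ ^ 2 = ‖e‖ ^ 2 + 2 * ⟪e, b - e⟫_ℝ + ‖b - e‖ ^ 2 := by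
    have : b = e + (b - e) := by abel
    conv_lhs => rw [this]
    rw [norm_add_sq_real]
  rw [h]; ring

variable {ι : Type*} [Fintype ι]

/-- **The linear term is `−2 Σ ⟪F_i, u_i⟫`.** For symmetric weights `ω i j = ω j i`,
`Σ_i Σ_j ω i j ⟪y j − y i, u j − u i⟫ = −2 Σ_i ⟪F i, u i⟫` with `F i = Σ_j ω i j • (y j − y i)`. -/
theorem sum_linear_eq_forces (ω : ι → ι → ℝ) (hω : ∀ i j, ω i j = ω j i) (y u : ι → E) :
    ∑ i, ∑ j, ω i j * ⟪y j - y i, u j - u i⟫_ℝ = -2 * ∑ i, ⟪(∑ j, ω i j • (y j - y i)), u i⟫_ℝ := by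
  classical
  have hsplit : ∀ i j, ω i j * ⟪y j - y i, u j - u i⟫_ℝ =
      ω i j * ⟪y j - y i, u j⟫_ℝ - ω i j * ⟪y j - y i, u i⟫_ℝ := fun i j => by
    rw [inner_sub_right]; ring
  simp_rw [hsplit, Finset.sum_sub_distrib]
  -- swap the double sum in the first block and use symmetry
  have hswap : ∑ i, ∑ j, ω i j * ⟪y j - y i, u j⟫_ℝ = -∑ i, ∑ j, ω i j * ⟪y j - y i, u i⟫_ℝ := by
    rw [Finset.sum_comm]
    rw [← Finset.sum_neg_distrib]
    refine Finset.sum_congr rfl fun i _ => ?_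
    rw [← Finset.sum_neg_distrib]
    refine Finset.sum_congr rfl fun j _ => ?_
    rw [hω j i, ← neg_sub (y j) (y i), inner_neg_left]; ring
  rw [hswap]
  have hF : ∀ i, ∑ j, ω i j * ⟪y j - y i, u i⟫_ℝ = ⟪(∑ j, ω i j • (y j - y i)), u i⟫_ℝ := fun i => by
    rw [sum_inner]
    refine Finset.sum_congr rfl fun j _ => ?_
    rw [real_inner_smul_left]
  simp_rw [hF]
  ring

/-- **Summed prestress split.** For symmetric weights and any well `W` (depending on the pair), with bond vectors
`b = x j − x i`, reference bonds `e = y j − y i` and displacements `u = x − y`: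
`Σ_{i,j} [W(|b|²) − W(|e|²)] = Σ_{i,j} [W̃(b) − W̃(e)] + Σ_{i,j} ω|b − e|² − 4 Σ_i ⟪F_i, u_i⟫`. -/
theorem sum_split (W : ι → ι → ℝ → ℝ) (ω : ι → ι → ℝ) (hω : ∀ i j, ω i j = ω j i) (x y : ι → E) :
    ∑ i, ∑ j, (W i j (‖x j - x i‖ ^ 2) - W i j (‖y j - y i‖ ^ 2)) =
      ∑ i, ∑ j, ((W i j (‖x j - x i‖ ^ 2) - ω i j * ‖x j - x i‖ ^ 2) -
          (W i j (‖y j - y i‖ ^ 2) - ω i j * ‖y j - y i‖ ^ 2)) +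
        ∑ i, ∑ j, ω i j * ‖(x j - x i) - (y j - y i)‖ ^ 2 -
          4 * ∑ i, ⟪(∑ j, ω i j • (y j - y i)), x i - y i⟫_ℝ := by
  have hlin := sum_linear_eq_forces ω hω y (fun i => x i - y i)
  have hb : ∀ i j, (x j - y j) - (x i - y i) = (x j - x i) - (y j - y i) := fun i j => by abel
  simp_rw [hb] at hlin
  have h1 : ∀ i j, W i j (‖x j - x i‖ ^ 2) - W i j (‖y j - y i‖ ^ 2) =
      ((W i j (‖x j - x i‖ ^ 2) - ω i j * ‖x j - x i‖ ^ 2) -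
          (W i j (‖y j - y i‖ ^ 2) - ω i j * ‖y j - y i‖ ^ 2)) +
        ω i j * ‖(x j - x i) - (y j - y i)‖ ^ 2 + 2 * (ω i j * ⟪y j - y i, (x j - x i) - (y j - y i)⟫_ℝ) :=
    fun i j => by rw [bond_split (W i j) (ω i j)]; ring
  simp_rw [h1, Finset.sum_add_distrib, ← Finset.mul_sum, hlin]
  ring

/-- **Force balance kills the linear term in the interior.** If the reference is force-balanced at every site of
`s` (`F i = 0` for `i ∈ s`), the linear term is carried by the complement alone (the boundary flux):
`Σ_i ⟪F_i, u_i⟫ = Σ_{i ∉ s} ⟪F_i, u_i⟫` (`F_i = Σ_j ω i j • (y j − y i)`). -/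
theorem sum_linear_eq_boundary [DecidableEq ι] (ω : ι → ι → ℝ) (y u : ι → E) (s : Finset ι)
    (hbal : ∀ i ∈ s, (∑ j, ω i j • (y j - y i)) = 0) :
    ∑ i, ⟪(∑ j, ω i j • (y j - y i)), u i⟫_ℝ = ∑ i ∈ Finset.univ.filter (fun i => i ∉ s), ⟪(∑ j, ω i j • (y j - y i)), u i⟫_ℝ := by
  rw [← Finset.sum_filter_add_sum_filter_not Finset.univ (fun i => i ∈ s)]
  have h0 : ∑ i ∈ Finset.univ.filter (fun i => i ∈ s), ⟪(∑ j, ω i j • (y j - y i)), u i⟫_ℝ = 0 :=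
    Finset.sum_eq_zero fun i hi => by
      rw [hbal i (Finset.mem_filter.1 hi).2, inner_zero_left]
  rw [h0, zero_add]

/-- **Registered stub `stub_prestressSplit` (S4a) of crux stmt-AtomisticToContinuum-13603, line prestress-split-korn**:
the summed prestress split on `Fin n → ℝ³` (statement `PrestressSplit` of the line's Defs/skeleton, verbatim). -/
theorem stub_prestressSplit :
    ∀ (n : ℕ) (W : Fin n → Fin n → ℝ → ℝ) (ω : Fin n → Fin n → ℝ), (∀ i j, ω i j = ω j i) →
    ∀ x y : Fin n → EuclideanSpace ℝ (Fin 3),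
      ∑ i, ∑ j, (W i j (‖x j - x i‖ ^ 2) - W i j (‖y j - y i‖ ^ 2)) =
        ∑ i, ∑ j, ((W i j (‖x j - x i‖ ^ 2) - ω i j * ‖x j - x i‖ ^ 2) -
            (W i j (‖y j - y i‖ ^ 2) - ω i j * ‖y j - y i‖ ^ 2)) +
          ∑ i, ∑ j, ω i j * ‖(x j - x i) - (y j - y i)‖ ^ 2 -
            4 * ∑ i, ⟪∑ j, ω i j • (y j - y i), x i - y i⟫_ℝ :=
  fun _ W ω hω x y => sum_split W ω hω x y

end Summit.AtomisticToContinuum.Crystallization.Theorems.PrestressSplitKorn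

end
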